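import Summits.Ventures.HodgeRepro2.T5SU11SphericalODE

/-!
# Green's identity for the radial Laplacian `L u = (sinh 2t · u')' / sinh 2t` and the diagonalisation
of the spherical transform: `(L u)^(λ) = λ(λ − 2) û(λ)`

The radial part of the Laplacian of `SU(1,1)/K` in the Cartan parameter is
`L u = u'' + 2 coth 2t · u'`, i.e. `sinh 2t · L u = (sinh 2t · u')'`. Two integrations by parts
(`intervalIntegral.integral_mul_deriv_eq_deriv_mul`) give **Green's identity**
`∫_0^R (sinh 2t u')' v − ∫_0^R u (sinh 2t v')' = sinh 2R (u'(R) v(R) − u(R) v'(R))` for `C²` functions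
`u, v` (`green_identity`; the boundary term at `0` vanishes because `sinh 0 = 0`). Since `φ_λ(a_t)`
solves the radial equation `(sinh 2t φ')' = λ(λ − 2) sinh 2t φ` (`T5SU11SphericalODE`),
**`∫_0^R (sinh 2t u'' + 2 cosh 2t u') φ_λ(a_t) dt = λ(λ − 2) ∫_0^R sinh 2t u φ_λ(a_t) dt`** for every
`C²` function `u` with `u(R) = u'(R) = 0` (`integral_radial_laplacian_mul_sph`), and on `(0, ∞)` for `u`
supported in `[0, R)` (`integral_radial_laplacian_mul_sph_Ioi`): in the Cartan form of the spherical
transform (`T5SU11SphericalTransformCartan`: `f̂(λ) = π ∫_0^∞ sinh 2t f(a_t) φ_λ(a_t) dt`), the transform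
of `L u` is `λ(λ − 2)` times the transform of `u` — the spherical transform diagonalises the radial
Laplacian with eigenvalue `λ(λ − 2ρ)`, `ρ = 1`. Nothing is claimed about (N).

Blind lane: Mathlib + the HodgeRepro2 prefix only; no sorry; axioms ⊆ {propext, Classical.choice,
Quot.sound}.
-/

namespace Summit.Ventures.HodgeRepro2.T5SU11RadialLaplacian

open MeasureTheory Metric Set Filter Topology intervalIntegral
open T5SU11Unimodular T5SU11Cartan T5SU11SphericalFunction T5SU11SphericalContinuous
  T5SU11SphericalODE
open scoped Real

/-! ### Green's identity -/

/-- The derivative of `t ↦ sinh 2t · u'(t)` is `2 cosh 2t · u' + sinh 2t · u''`. -/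
lemma hasDerivAt_sinh_two_mul_mul {u' u'' : ℝ → ℝ} (hu' : ∀ t, HasDerivAt u' (u'' t) t) (t : ℝ) :
    HasDerivAt (fun t => Real.sinh (2 * t) * u' t)
      (2 * Real.cosh (2 * t) * u' t + Real.sinh (2 * t) * u'' t) t := by
  have hs : HasDerivAt (fun t => Real.sinh (2 * t)) (2 * Real.cosh (2 * t)) t := by
    have := (Real.hasDerivAt_sinh (2 * t)).comp t ((hasDerivAt_id t).const_mul 2)
    refine this.congr_deriv ?_
    simp only [mul_one]
    ring
  refine (hs.mul (hu' t)).congr_deriv ?_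
  ring

/-- **Green's identity for the radial Laplacian**: for `C²` functions `u, v` on `[0, R]` (with
`(sinh 2t u')'` and `(sinh 2t v')'` interval-integrable),
`∫_0^R (sinh 2t u'' + 2 cosh 2t u') v − ∫_0^R u (sinh 2t v'' + 2 cosh 2t v') = sinh 2R (u'(R) v(R) − u(R) v'(R))`. -/
theorem green_identity {u u' u'' v v' v'' : ℝ → ℝ} {R : ℝ}
    (hu : ∀ t, HasDerivAt u (u' t) t) (hu' : ∀ t, HasDerivAt u' (u'' t) t)
    (hW : IntervalIntegrable (fun t => 2 * Real.cosh (2 * t) * u' t + Real.sinh (2 * t) * u'' t)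
      volume 0 R)
    (hv : ∀ t, HasDerivAt v (v' t) t) (hv' : ∀ t, HasDerivAt v' (v'' t) t)
    (hW' : IntervalIntegrable (fun t => 2 * Real.cosh (2 * t) * v' t + Real.sinh (2 * t) * v'' t)
      volume 0 R) :
    (∫ t in (0 : ℝ)..R, (Real.sinh (2 * t) * u'' t + 2 * Real.cosh (2 * t) * u' t) * v t)
      - ∫ t in (0 : ℝ)..R, u t * (Real.sinh (2 * t) * v'' t + 2 * Real.cosh (2 * t) * v' t)
      = Real.sinh (2 * R) * (u' R * v R - u R * v' R) := by
  have hcu' : Continuous u' := continuous_iff_continuousAt.mpr fun t => (hu' t).continuousAt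
  have hcv' : Continuous v' := continuous_iff_continuousAt.mpr fun t => (hv' t).continuousAt
  -- first integration by parts, `U = v`, `V = sinh 2t · u'`
  have h1 := integral_mul_deriv_eq_deriv_mul (a := 0) (b := R) (u := v) (u' := v')
    (v := fun t => Real.sinh (2 * t) * u' t)
    (v' := fun t => 2 * Real.cosh (2 * t) * u' t + Real.sinh (2 * t) * u'' t)
    (fun t _ => hv t) (fun t _ => hasDerivAt_sinh_two_mul_mul hu' t) (hcv'.intervalIntegrable _ _) hW
  -- second integration by parts, `U = u`, `V = sinh 2t · v'`
  have h2 := integral_mul_deriv_eq_deriv_mul (a := 0) (b := R) (u := u) (u' := u')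
    (v := fun t => Real.sinh (2 * t) * v' t)
    (v' := fun t => 2 * Real.cosh (2 * t) * v' t + Real.sinh (2 * t) * v'' t)
    (fun t _ => hu t) (fun t _ => hasDerivAt_sinh_two_mul_mul hv' t) (hcu'.intervalIntegrable _ _) hW'
  beta_reduce at h1 h2
  have e1 : ∫ t in (0 : ℝ)..R, (Real.sinh (2 * t) * u'' t + 2 * Real.cosh (2 * t) * u' t) * v t
      = ∫ t in (0 : ℝ)..R, v t * (2 * Real.cosh (2 * t) * u' t + Real.sinh (2 * t) * u'' t) :=
    integral_congr fun t _ => by ring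
  have e2 : ∫ t in (0 : ℝ)..R, u t * (Real.sinh (2 * t) * v'' t + 2 * Real.cosh (2 * t) * v' t)
      = ∫ t in (0 : ℝ)..R, u t * (2 * Real.cosh (2 * t) * v' t + Real.sinh (2 * t) * v'' t) :=
    integral_congr fun t _ => by ring
  have e3 : ∫ t in (0 : ℝ)..R, v' t * (Real.sinh (2 * t) * u' t)
      = ∫ t in (0 : ℝ)..R, u' t * (Real.sinh (2 * t) * v' t) :=
    integral_congr fun t _ => by ring
  rw [e1, e2, h1, h2, e3]
  simp only [mul_zero, Real.sinh_zero, zero_mul, sub_zero]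
  ring

/-! ### The spherical transform diagonalises the radial Laplacian -/

section measure

variable [MeasurableSpace Circle] [BorelSpace Circle]

/-- **`(L u)^(λ) = λ(λ − 2) û(λ)` on `[0, R]`**: for a `C²` function `u` with `u(R) = u'(R) = 0`,
`∫_0^R (sinh 2t u'' + 2 cosh 2t u') φ_λ(a_t) dt = λ(λ − 2) ∫_0^R sinh 2t u φ_λ(a_t) dt`. -/
theorem integral_radial_laplacian_mul_sph (lam : ℝ) {u u' u'' : ℝ → ℝ} {R : ℝ}
    (hu : ∀ t, HasDerivAt u (u' t) t) (hu' : ∀ t, HasDerivAt u' (u'' t) t)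
    (hW : IntervalIntegrable (fun t => 2 * Real.cosh (2 * t) * u' t + Real.sinh (2 * t) * u'' t)
      volume 0 R)
    (hR : u R = 0) (hR' : u' R = 0) :
    ∫ t in (0 : ℝ)..R, (Real.sinh (2 * t) * u'' t + 2 * Real.cosh (2 * t) * u' t) * sph lam (hyp t)
      = lam * (lam - 2) * ∫ t in (0 : ℝ)..R, Real.sinh (2 * t) * u t * sph lam (hyp t) := by
  obtain ⟨φ', φ'', hφ, hφ', hode⟩ := exists_hasDerivAt_sph_hyp_ode lam
  have hW' : IntervalIntegrable (fun t => 2 * Real.cosh (2 * t) * φ' t + Real.sinh (2 * t) * φ'' t)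
      volume 0 R := by
    have e : (fun t => 2 * Real.cosh (2 * t) * φ' t + Real.sinh (2 * t) * φ'' t)
        = fun t => lam * (lam - 2) * Real.sinh (2 * t) * sph lam (hyp t) := by
      funext t
      rw [← hode t]
      ring
    rw [e]
    exact ((continuous_const.mul (by fun_prop : Continuous fun t => Real.sinh (2 * t))).mul
      (continuous_sph_hyp lam)).intervalIntegrable _ _
  have hg := green_identity hu hu' hW hφ hφ' hW'
  rw [hR, hR', zero_mul, zero_mul, sub_zero, mul_zero, sub_eq_zero] at hg
  rw [hg, ← intervalIntegral.integral_const_mul]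
  refine integral_congr fun t _ => ?_
  rw [hode t]
  ring

/-- **`(L u)^(λ) = λ(λ − 2) û(λ)` on `(0, ∞)`** for a `C²` function `u` supported in `[0, R)` (with
`u, u', u''` vanishing on `[R, ∞)`). -/
theorem integral_radial_laplacian_mul_sph_Ioi (lam : ℝ) {u u' u'' : ℝ → ℝ} {R : ℝ} (hR0 : 0 < R)
    (hu : ∀ t, HasDerivAt u (u' t) t) (hu' : ∀ t, HasDerivAt u' (u'' t) t)
    (hW : IntervalIntegrable (fun t => 2 * Real.cosh (2 * t) * u' t + Real.sinh (2 * t) * u'' t)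
      volume 0 R)
    (hs : ∀ t, R ≤ t → u t = 0) (hs' : ∀ t, R ≤ t → u' t = 0) (hs'' : ∀ t, R ≤ t → u'' t = 0) :
    ∫ t in Ioi (0 : ℝ), (Real.sinh (2 * t) * u'' t + 2 * Real.cosh (2 * t) * u' t) * sph lam (hyp t)
      = lam * (lam - 2) * ∫ t in Ioi (0 : ℝ), Real.sinh (2 * t) * u t * sph lam (hyp t) := by
  have hsub : Ioc (0 : ℝ) R ⊆ Ioi 0 := Ioc_subset_Ioi_self
  have e1 : ∫ t in Ioi (0 : ℝ), (Real.sinh (2 * t) * u'' t + 2 * Real.cosh (2 * t) * u' t)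
      * sph lam (hyp t)
      = ∫ t in (0 : ℝ)..R, (Real.sinh (2 * t) * u'' t + 2 * Real.cosh (2 * t) * u' t)
        * sph lam (hyp t) := by
    rw [integral_of_le hR0.le]
    refine setIntegral_eq_of_subset_of_forall_sdiff_eq_zero measurableSet_Ioi hsub fun t ht => ?_
    have hRt : R ≤ t := by
      rcases ht with ⟨h1, h2⟩
      by_contra h
      exact h2 ⟨h1, le_of_not_ge h⟩
    rw [hs' t hRt, hs'' t hRt]
    ring
  have e2 : ∫ t in Ioi (0 : ℝ), Real.sinh (2 * t) * u t * sph lam (hyp t)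
      = ∫ t in (0 : ℝ)..R, Real.sinh (2 * t) * u t * sph lam (hyp t) := by
    rw [integral_of_le hR0.le]
    refine setIntegral_eq_of_subset_of_forall_sdiff_eq_zero measurableSet_Ioi hsub fun t ht => ?_
    have hRt : R ≤ t := by
      rcases ht with ⟨h1, h2⟩
      by_contra h
      exact h2 ⟨h1, le_of_not_ge h⟩
    rw [hs t hRt]
    ring
  rw [e1, e2]
  exact integral_radial_laplacian_mul_sph lam hu hu' hW (hs R le_rfl) (hs' R le_rfl)

end measure

end Summit.Ventures.HodgeRepro2.T5SU11RadialLaplacian
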